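import Literature.NumberTheory.GaloisRepresentations.WildInertia
import Literature.NumberTheory.GaloisRepresentations.TameInertiaKummerProofs
import Literature.NumberTheory.GaloisRepresentations.LocalWeilDatumUnramified
import Literature.NumberTheory.GaloisRepresentations.WeilGroupDensityProofs
import Literature.NumberTheory.GaloisRepresentations.ModNCyclotomicCharacter
import Literature.NumberTheory.GaloisRepresentations.ModPGaloisRepProofs
import Literature.NumberTheory.GaloisRepresentations.TateH2VanishingCharacterCriterion
import Literature.NumberTheory.GaloisRepresentations.TateProjectiveLiftingH2Proofs
import Literature.NumberTheory.GaloisRepresentations.TateH2VanishingCorestriction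
import HarnessLib

/-!
# Tate's theorem `H²(G_ℚ, ℚ/ℤ) = 0` at level one, I: locally constant characters of `Γ_F`,
# `F` a non-archimedean local field — unramified divisibility and the tame relations

Sibling proof file (theorems only; no definition, no named fact, no instance) of
`TateProjectiveLifting.lean`, for the proof of the named fact
`Literature.NumberTheory.GaloisRepresentations.Tate_projectiveLifting` (Serre, *Modular forms of
weight one and Galois representations*, Durham 1977, §6.1 Cor. of Thm. 4) along Serre's own route
of §6.5 run over `ℚ` with cyclotomic characters.  In §6.5 (b)–(c) Serre uses, at every place `v`,
"the known structure of `K_v^×`" through local class field theory: `δ(χ_v)` only depends on the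
restriction of `χ_v` to `μ_p`, i.e. a character of `Γ_{K_v}` is a `p`-th multiple iff it kills the
image of `μ_p`.  On the Galois side this is the structure of the tame quotient of `Γ_F`
(Serre, *Local Fields*, IV §2 and *Corps locaux* XIV; Serre, Invent. Math. 15 (1972) §1.3, §1.8:
`I_t = lim← μ_d` is pro-cyclic and Frobenius acts on it by `u ↦ u^q`), which the tree proves
(`WildInertia.lean`, `TameInertiaKummerProofs.lean`, `LocalWeilDatumUnramified.lean`).  This file
draws the three consequences used at level one, for locally constant additive characters
`λ : Γ_F → ℚ/ℤ = AddCircle (1 : ℚ)` (i.e. `H¹(Γ_F, ℚ/ℤ)`):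

* `exists_zpow_eq_of_absInertia_le_ker` — **`Γ_F / I_F` is procyclic, generated by Frobenius**:
  a homomorphism with open kernel containing `I_F` takes every `σ` to a power of the image of an
  arithmetic Frobenius (density of the Weil group, `WeilGroup.denseRange_toAbsGalois_holds`);
* `unramified_character_nsmul_divisible` — **unramified characters are divisible**: if `λ` kills
  `I_F` then for every `n ≥ 1` there is a locally constant unramified character `λ'` with
  `n • λ' = λ` (the unramified level `F_{m}` of degree `m = n · (exponent of λ)`: `Γ_F` acts on a
  primitive `(q^m - 1)`-th root of unity through a cyclic quotient of order `m` generated by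
  Frobenius, `LocalWeilDatum.smul_eq_self_iff_dvd_of_isFrobPow`); hence the image of
  `H²(Γ_F/I_F, ℤ/p)`-type classes dies at level one (used for the finiteness of the support and
  for the vanishing of `δ` on unramified characters, Serre §6.5 (c) (i));
* `tame_nsmul_apply_eq_zero_of_mem_absInertia` — **the tame relation** `(q - 1) · λ(σ) = 0` up to
  a power of the residue characteristic, for `σ ∈ I_F` ("`s u s⁻¹ ≡ u^q (mod I_p)`",
  `conj_mul_pow_inv_mem_absWildInertia`, and `I_p` is pro-`p`, `absWildInertia_isProP_holds`):
  `p'^a (q - 1) • λ σ = 0` for some `a`, `p' = char 𝓀[F]`;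
* `tame_character_eq_zsmul_on_absInertia` — **tame cyclicity**: two locally constant characters
  `λ, ψ` of exponent `d` prime to `p'` on `I_F`, with `ψ(I_F) ∋ 1/d`, satisfy `λ = k • ψ` on `I_F`
  for an integer `k` (`absInertia_exists_eq_mul_zpow`: `I_F = N · ⟨g⟩` modulo the common kernel).

## References

* J.-P. Serre, *Modular forms of weight one and Galois representations*, in: Algebraic Number
  Fields (Durham 1975), Academic Press 1977, §6.5 (b), (c). [SerreDurham1977]
* J.-P. Serre, *Local Fields*, GTM 67 (1979), Ch. IV §2 (Cor. 1–3 of Prop. 7), §4 (Prop. 16),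
  Ch. XIII §4 App. [SerreLocalFields1979]
* J.-P. Serre, *Propriétés galoisiennes des points d'ordre fini des courbes elliptiques*,
  Invent. Math. 15 (1972), §1.3, §1.8 Prop. 6. [SerreInventiones1972]
-/

noncomputable section

open Field ValuativeRel
open scoped Pointwise Valued

namespace Literature.NumberTheory.GaloisRepresentations

open GaloisRepresentations.IsNonarchimedeanLocalField

universe u

/-! ### Additive characters: elementary identities -/

section CharacterAux

variable {G : Type*} [Group G] {A : Type*} [AddCommGroup A]

/-- An additive character satisfies `ψ(t⁻¹) = -ψ(t)`. [folklore] -/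
theorem character_apply_inv {ψ : G → A} (hψ : ∀ σ τ, ψ (σ * τ) = ψ σ + ψ τ) (t : G) :
    ψ t⁻¹ = -ψ t := by
  have h := hψ t t⁻¹
  rw [mul_inv_cancel, character_apply_one hψ] at h
  rw [eq_neg_iff_add_eq_zero, add_comm]
  exact h.symm

/-- An additive character satisfies `ψ(t ^ n) = n • ψ(t)` for `n : ℤ`. [folklore] -/
theorem character_apply_zpow {ψ : G → A} (hψ : ∀ σ τ, ψ (σ * τ) = ψ σ + ψ τ) (t : G) (n : ℤ) :
    ψ (t ^ n) = n • ψ t := by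
  obtain ⟨k, rfl | rfl⟩ := n.eq_nat_or_neg
  · rw [zpow_natCast, character_apply_pow hψ, natCast_zsmul]
  · rw [zpow_neg, zpow_natCast, character_apply_inv hψ, character_apply_pow hψ, neg_zsmul,
      natCast_zsmul]

/-- An additive character is invariant under conjugation. [folklore] -/
theorem character_apply_conj {ψ : G → A} (hψ : ∀ σ τ, ψ (σ * τ) = ψ σ + ψ τ) (τ σ : G) :
    ψ (τ * σ * τ⁻¹) = ψ σ := by
  rw [hψ, hψ, character_apply_inv hψ]
  abel

/-- The kernel of an additive character as a subgroup: there is a monoid homomorphism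
`f : G →* Multiplicative A` with `f g = ofAdd (ψ g)`, so that `g ∈ ker f ↔ ψ g = 0`. [folklore] -/
theorem exists_monoidHom_ker_iff {ψ : G → A} (hψ : ∀ σ τ, ψ (σ * τ) = ψ σ + ψ τ) :
    ∃ f : G →* Multiplicative A, (∀ g, f g = Multiplicative.ofAdd (ψ g)) ∧
      ∀ g, g ∈ f.ker ↔ ψ g = 0 := by
  refine ⟨{ toFun := fun g => Multiplicative.ofAdd (ψ g),
            map_one' := by rw [character_apply_one hψ]; rfl,
            map_mul' := fun σ τ => by rw [hψ]; rfl }, fun g => rfl, fun g => ?_⟩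
  rw [MonoidHom.mem_ker]
  show Multiplicative.ofAdd (ψ g) = Multiplicative.ofAdd 0 ↔ ψ g = 0
  exact Multiplicative.ofAdd.apply_eq_iff_eq

/-- A function on a topological group which is invariant under right multiplication by an open
subgroup is locally constant. [folklore] -/
theorem isLocallyConstant_of_mul_mem {G : Type*} [Group G] [TopologicalSpace G]
    [ContinuousMul G] {X : Type*} (f : G → X) (U : Subgroup G)
    (hU : IsOpen (U : Set G)) (hf : ∀ σ, ∀ u ∈ U, f (σ * u) = f σ) : IsLocallyConstant f := by
  rw [IsLocallyConstant.iff_exists_open]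
  intro σ
  refine ⟨{τ | σ⁻¹ * τ ∈ U}, ?_, by simp [U.one_mem], fun τ hτ => ?_⟩
  · exact hU.preimage (continuous_const.mul continuous_id)
  · have : τ = σ * (σ⁻¹ * τ) := by rw [mul_inv_cancel_left]
    rw [this]
    exact hf σ _ hτ

end CharacterAux

/-! ### `Γ_F / I_F` is procyclic -/

section Local

variable (F : Type u) [Field F] [ValuativeRel F] [TopologicalSpace F] [IsNonarchimedeanLocalField F]

/-- **`Γ_F/I_F` is procyclic, generated by Frobenius**: a homomorphism `h : Γ_F → Q` with open
kernel containing the inertia group `I_F` takes every `σ ∈ Γ_F` to an integral power of `h(φ)`,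
`φ` any arithmetic Frobenius.  (The Weil group `W_F = ⋃ₙ φⁿ I_F` is dense in `Γ_F`,
`WeilGroup.denseRange_toAbsGalois_holds`, and `h` is locally constant.)
Ref: Serre, *Local Fields* (1979), Ch. XIII §4 (App.); Tate, *Number theoretic background*
(Corvallis 1979), (1.4.1). [cite: SerreLocalFields1979, Ch. XIII §4 App.] -/
theorem exists_zpow_eq_of_absInertia_le_ker {Q : Type*} [Group Q]
    (h : absoluteGaloisGroup F →* Q)
    (hopen : IsOpen ((h.ker : Subgroup _) : Set (absoluteGaloisGroup F)))
    (hI : absInertia F ≤ h.ker) {φ : absoluteGaloisGroup F} (hφ : IsAbsArithFrob φ)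
    (σ : absoluteGaloisGroup F) : ∃ n : ℤ, h σ = h φ ^ n := by
  -- the open set `σ · ker h` meets the dense Weil group
  have hopen' : IsOpen ((fun τ => σ * τ) '' (h.ker : Set (absoluteGaloisGroup F))) :=
    (isOpenMap_mul_left σ) _ hopen
  obtain ⟨w, hw⟩ := (WeilGroup.denseRange_toAbsGalois_holds F).exists_mem_open hopen'
    ⟨σ, 1, h.ker.one_mem, mul_one σ⟩
  obtain ⟨τ, hτ, hτw⟩ := hw
  have hhw : h (WeilGroup.toAbsGalois F w) = h σ := by
    rw [← hτw, map_mul, show h τ = 1 from hτ, mul_one]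
  -- `w = (inertia) · φⁿ`
  obtain ⟨n, hn⟩ := WeilGroup.exists_isFrobPow_toAbsGalois IsFrobPow.mul_holds w
  have hφn : IsFrobPow (φ ^ n) n := by
    simpa using (IsAbsArithFrob.isFrobPow_holds hφ).zpow n
  have hmem : WeilGroup.toAbsGalois F w * (φ ^ n)⁻¹ ∈ absInertia F :=
    IsFrobPow.mul_inv_mem_absInertia_holds hn hφn
  have h1 : h (WeilGroup.toAbsGalois F w * (φ ^ n)⁻¹) = 1 := hI hmem
  rw [map_mul, map_inv, mul_inv_eq_one, hhw, map_zpow] at h1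
  exact ⟨n, h1⟩

/-! ### Unramified characters are divisible -/

/-- **Unramified characters of `Γ_F` are divisible.**  Let `λ : Γ_F → ℚ/ℤ` be a locally constant
additive character which kills the inertia group `I_F`, and `n ≥ 1`.  Then there is a locally
constant additive character `λ'` killing `I_F` with `n • λ' = λ`.  (With `M • λ = 0` and
`m = n M`, let `ζ` be a primitive `(q^m - 1)`-th root of unity, generating the unramified extension
of degree `m`: `I_F` fixes `ζ`, and a power `φ^k` of an arithmetic Frobenius fixes `ζ` iff
`m ∣ k`; as `Γ_F / (I_F · ker)` is generated by `φ`, every `σ` acts as `φ^{j(σ)}` with `j(σ)`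
well defined modulo `m`, and `λ' (σ) = j(σ) • t'`, `n t' = λ(φ)`, works.)  This is the
divisibility of `H¹(Γ_F/I_F, ℚ/ℤ) = Hom(Ẑ, ℚ/ℤ)`, i.e. "`δ` vanishes on unramified characters"
in Serre's §6.5.
Ref: Serre, *Local Fields* (1979), Ch. IV §4, Prop. 16 and Cor.; Ch. XIII §4 App.
[cite: SerreDurham1977, §6.5 (b)–(c)] [cite: SerreLocalFields1979, Ch. IV §4 Prop. 16] -/
theorem unramified_character_nsmul_divisible
    (lam : absoluteGaloisGroup F → AddCircle (1 : ℚ)) (hlc : IsLocallyConstant lam)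
    (hadd : ∀ σ τ, lam (σ * τ) = lam σ + lam τ) (hI : ∀ σ ∈ absInertia F, lam σ = 0)
    {n : ℕ} (hn : 0 < n) :
    ∃ lam' : absoluteGaloisGroup F → AddCircle (1 : ℚ), IsLocallyConstant lam' ∧
      (∀ σ τ, lam' (σ * τ) = lam' σ + lam' τ) ∧ (∀ σ ∈ absInertia F, lam' σ = 0) ∧
      ∀ σ, n • lam' σ = lam σ := by
  classical
  haveI : CompactSpace (absoluteGaloisGroup F) := absoluteGaloisGroup_compactSpace F
  -- an arithmetic Frobenius
  obtain ⟨φ, hφ⟩ := exists_isAbsArithFrob_holds F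
  have hφ1 : IsFrobPow φ 1 := IsAbsArithFrob.isFrobPow_holds hφ
  -- an exponent `M` of `lam`, and the level `m = n * M`
  obtain ⟨M, hM0, hM⟩ := addCircle_exists_nsmul_comp_eq_zero lam hlc.range_finite
  obtain ⟨m, hm_def⟩ : ∃ m : ℕ, m = n * M := ⟨_, rfl⟩
  have hm : 0 < m := hm_def ▸ Nat.mul_pos hn hM0
  -- the primitive `(q^m - 1)`-th root of unity and the mod `q^m - 1` cyclotomic character
  obtain ⟨N, hN_def⟩ : ∃ N : ℕ, N = residueFieldCard F ^ m - 1 := ⟨_, rfl⟩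
  have hN0 : N ≠ 0 := hN_def ▸ LocalWeilDatum.residueFieldCard_pow_sub_one_ne_zero F m hm
  have hpN : ¬ ringChar 𝓀[F] ∣ N :=
    hN_def ▸ LocalWeilDatum.not_ringChar_dvd_residueFieldCard_pow_sub_one F hm
  haveI : NeZero N := ⟨hN0⟩
  haveI : NeZero ((N : ℕ) : F) := ⟨hN_def ▸ natCast_residueFieldCard_pow_sub_one_ne_zero F hm.ne'⟩
  set ζ : AlgebraicClosure F := LocalWeilDatum.rootOfUnramifiedLevel F m with hζ_def
  have hζ : IsPrimitiveRoot ζ N :=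
    hN_def ▸ LocalWeilDatum.isPrimitiveRoot_rootOfUnramifiedLevel F hm
  set χ : absoluteGaloisGroup F →* (ZMod N)ˣ := modNCyclotomicCharacter F N with hχ_def
  -- `χ` kills inertia
  have hχI : ∀ σ ∈ absInertia F, χ σ = 1 := fun σ hσ => by
    have hfix : σ • ζ = ζ :=
      smul_eq_self_of_pow_eq_one_of_mem_absInertia hσ (Nat.pos_of_ne_zero hN0) hpN hζ.pow_eq_one
    ext
    have h1 := modNCyclotomicCharacter_eq_of_smul_eq_pow F N hζ σ (c := 1) (by rw [pow_one, hfix])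
    rw [hχ_def, h1, Units.val_one, Nat.cast_one]
  -- `χ (φ ^ k) = 1 → m ∣ k`
  have hχφ : ∀ k : ℕ, χ (φ ^ k) = 1 → m ∣ k := fun k hk => by
    have hσk : IsFrobPow (φ ^ k) (k : ℤ) := by simpa using hφ1.pow k
    have hsmul : (φ ^ k) • ζ = ζ := by
      have h1 := modNCyclotomicCharacter_spec F N (φ ^ k) ζ hζ.pow_eq_one
      rw [← hχ_def, hk, Units.val_one, ZMod.val_one_eq_one_mod] at h1
      rw [h1]
      conv_rhs => rw [← pow_one ζ, ← Nat.mod_add_div 1 N, pow_add, pow_mul, hζ.pow_eq_one,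
        one_pow, mul_one]
    exact (LocalWeilDatum.smul_eq_self_iff_dvd_of_isFrobPow F hm (hN_def ▸ hζ) hσk).mp hsmul
  have hχφz : ∀ z : ℤ, χ (φ ^ z) = 1 → (m : ℤ) ∣ z := fun z hz => by
    obtain ⟨k, rfl | rfl⟩ := z.eq_nat_or_neg
    · rw [zpow_natCast] at hz
      exact Int.natCast_dvd_natCast.mpr (hχφ k hz)
    · rw [zpow_neg, zpow_natCast, map_inv, inv_eq_one] at hz
      exact (dvd_neg).mpr (Int.natCast_dvd_natCast.mpr (hχφ k hz))
  -- the combined homomorphism `Λ = (lam, χ)`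
  let Λ : absoluteGaloisGroup F →* Multiplicative (AddCircle (1 : ℚ)) × (ZMod N)ˣ :=
    { toFun := fun σ => (Multiplicative.ofAdd (lam σ), χ σ)
      map_one' := by rw [character_apply_one hadd, map_one]; rfl
      map_mul' := fun σ τ => by rw [hadd, map_mul]; rfl }
  have hΛ : ∀ σ, Λ σ = (Multiplicative.ofAdd (lam σ), χ σ) := fun σ => rfl
  -- its kernel is open and contains `I_F`
  have hχker : ((χ.ker : Subgroup _) : Set (absoluteGaloisGroup F)) ∈ nhds (1 : absoluteGaloisGroup F) := by
    have hev := modNCyclotomicCharacter_eventually_eq_one F N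
    rw [Filter.Eventually] at hev
    exact hev
  have hΛker_nhds : ((Λ.ker : Subgroup _) : Set (absoluteGaloisGroup F)) ∈
      nhds (1 : absoluteGaloisGroup F) := by
    have h0 : lam ⁻¹' {lam 1} ∈ nhds (1 : absoluteGaloisGroup F) :=
      (hlc.isOpen_fiber (lam 1)).mem_nhds rfl
    refine Filter.mem_of_superset (Filter.inter_mem h0 hχker) ?_
    rintro σ ⟨h1, h2⟩
    rw [Set.mem_preimage, Set.mem_singleton_iff, character_apply_one hadd] at h1
    change σ ∈ Λ.ker
    rw [MonoidHom.mem_ker, hΛ, h1, show χ σ = 1 from h2]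
    rfl
  have hΛker : IsOpen ((Λ.ker : Subgroup _) : Set (absoluteGaloisGroup F)) :=
    Subgroup.isOpen_of_mem_nhds _ hΛker_nhds
  have hΛI : absInertia F ≤ Λ.ker := fun σ hσ => by
    rw [MonoidHom.mem_ker, hΛ, hI σ hσ, hχI σ hσ]
    rfl
  -- every `σ` is `φ ^ j` through `Λ`
  have hgen : ∀ σ, ∃ j : ℤ, lam σ = j • lam φ ∧ χ σ = χ φ ^ j := fun σ => by
    obtain ⟨j, hj⟩ := exists_zpow_eq_of_absInertia_le_ker F Λ hΛker hΛI hφ σ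
    rw [hΛ, hΛ, Prod.pow_mk, Prod.mk.injEq] at hj
    refine ⟨j, ?_, hj.2⟩
    have h1 := congrArg Multiplicative.toAdd hj.1
    rwa [toAdd_ofAdd, toAdd_zpow, toAdd_ofAdd] at h1
  choose j hjlam hjχ using hgen
  -- `t'` with `n • t' = lam φ`, so `m • t' = 0`
  obtain ⟨dv, hdv⟩ := addCircle_exists_fun_nsmul_eq hn
  set t' : AddCircle (1 : ℚ) := dv (lam φ) with ht'_def
  have ht' : n • t' = lam φ := hdv _
  have hmt' : m • t' = 0 := by
    rw [hm_def, mul_nsmul, ht', hM]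
  have hdvd_t' : ∀ z : ℤ, (m : ℤ) ∣ z → z • t' = 0 := fun z hz => by
    obtain ⟨c, rfl⟩ := hz
    rw [mul_comm, mul_zsmul, natCast_zsmul, hmt', zsmul_zero]
  -- the character `lam' σ = j σ • t'`
  set lam' : absoluteGaloisGroup F → AddCircle (1 : ℚ) := fun σ => j σ • t' with hlam'_def
  have hker' : ∀ u, χ u = 1 → lam' u = 0 := fun u hu => by
    apply hdvd_t'
    apply hχφz
    rw [map_zpow, ← hjχ, hu]
  have hadd' : ∀ σ τ, lam' (σ * τ) = lam' σ + lam' τ := fun σ τ => by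
    have key : (m : ℤ) ∣ (j (σ * τ) - (j σ + j τ)) := by
      apply hχφz
      rw [zpow_sub, zpow_add, map_mul, map_inv, map_mul, map_zpow, map_zpow, map_zpow, ← hjχ,
        ← hjχ, ← hjχ, ← map_mul, mul_inv_cancel]
    have h1 := hdvd_t' _ key
    rw [sub_zsmul, add_zsmul, ← sub_eq_add_neg, sub_eq_zero] at h1
    exact h1
  refine ⟨lam', ?_, hadd', fun σ hσ => hker' σ (hχI σ hσ), fun σ => ?_⟩
  · -- locally constant: invariant under the open subgroup `ker χ`
    refine isLocallyConstant_of_mul_mem lam' χ.ker (Subgroup.isOpen_of_mem_nhds _ hχker)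
      fun σ u hu => ?_
    rw [hadd', hker' u hu, add_zero]
  · change n • (j σ • t') = lam σ
    rw [smul_comm, ht']
    exact (hjlam σ).symm

/-! ### The tame relations -/

/-- **Frobenius acts on tame inertia by `u ↦ u^q`: the tame relation for characters.**  For a
locally constant additive character `λ : Γ_F → A` and `σ ∈ I_F` there is `a` with
`(p'^a (q - 1)) • λ σ = 0`, `q = #𝓀[F]`, `p' = char 𝓀[F]`: indeed `φ σ φ⁻¹ σ^{-q}` lies in the
wild inertia group (`conj_mul_pow_inv_mem_absWildInertia`), which is pro-`p'`
(`absWildInertia_isProP_holds`), and `λ(φ σ φ⁻¹ σ^{-q}) = (1 - q) λ(σ)`.  In particular a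
character of `I_F` of order prime to `p'` has exponent dividing `q - 1` — the Galois side of
"`K^× ⊇ μ_{q-1}`, and tamely ramified abelian extensions of `F` have `e ∣ q - 1`".
Ref: Serre, Invent. Math. 15 (1972), §1.8 Prop. 6; Serre, *Local Fields*, Ch. IV §2, Cor. 1–3
of Prop. 7. [cite: SerreInventiones1972, §1.8 Prop. 6] [cite: SerreDurham1977, §6.5 (b)] -/
theorem tame_nsmul_apply_eq_zero_of_mem_absInertia {A : Type*} [AddCommGroup A]
    (lam : absoluteGaloisGroup F → A) (hlc : IsLocallyConstant lam)
    (hadd : ∀ σ τ, lam (σ * τ) = lam σ + lam τ) {σ : absoluteGaloisGroup F}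
    (hσ : σ ∈ absInertia F) :
    ∃ a : ℕ, (ringChar 𝓀[F] ^ a * (residueFieldCard F - 1)) • lam σ = 0 := by
  obtain ⟨ϖ, hϖ⟩ := IsDiscreteValuationRing.exists_irreducible 𝒪[F]
  obtain ⟨φ, hφ⟩ := exists_isAbsArithFrob_holds F
  have hφ1 : IsFrobPow φ ((1 : ℕ) : ℤ) := by
    simpa using IsAbsArithFrob.isFrobPow_holds hφ
  have hw := conj_mul_pow_inv_mem_absWildInertia hϖ.ne_zero hφ1 hσ
  -- the kernel of `lam` as an open subgroup
  obtain ⟨f, hf, hfker⟩ := exists_monoidHom_ker_iff hadd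
  have hNopen : IsOpen ((f.ker : Subgroup _) : Set (absoluteGaloisGroup F)) := by
    have : ((f.ker : Subgroup _) : Set (absoluteGaloisGroup F)) = lam ⁻¹' {0} := by
      ext τ
      exact hfker τ
    rw [this]
    exact hlc.isOpen_fiber 0
  obtain ⟨a, ha⟩ := absWildInertia_isProP_holds F hϖ hw f.ker hNopen
  refine ⟨a, ?_⟩
  have h1 : lam ((φ * σ * φ⁻¹ * (σ ^ residueFieldCard F ^ 1)⁻¹) ^ ringChar 𝓀[F] ^ a) = 0 :=
    (hfker _).mp ha
  rw [character_apply_pow hadd, hadd, character_apply_inv hadd, character_apply_conj hadd,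
    character_apply_pow hadd, pow_one] at h1
  have hq : residueFieldCard F = (residueFieldCard F - 1) + 1 :=
    (Nat.sub_add_cancel (one_lt_residueFieldCard F).le).symm
  have h2 : lam σ + -(residueFieldCard F • lam σ) = -((residueFieldCard F - 1) • lam σ) := by
    conv_lhs => rw [hq, add_nsmul, one_nsmul]
    abel
  rw [h2, smul_neg, neg_eq_zero] at h1
  rw [mul_nsmul', h1]

/-- **Tame cyclicity** (the tame inertia `I_F/P_F = lim← μ_d` is pro-cyclic): let `λ, ψ : Γ_F → ℚ/ℤ`
be locally constant additive characters which are `d`-torsion on `I_F`, `d` prime to the residue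
characteristic, and suppose `ψ(σ₀) = 1/d` for some `σ₀ ∈ I_F`.  Then `λ = k • ψ` on `I_F` for some
integer `k`.  (Modulo the common kernel `N`, `I_F = N · ⟨g⟩` by `absInertia_exists_eq_mul_zpow`;
`λ(g)` is `d`-torsion, hence a multiple of `1/d = ψ(σ₀) ∈ ℤ ψ(g)`.)  This is the statement that the
characters of `I_F` of exponent `d` form the cyclic group generated by the Kummer character
`θ_d` (`exists_eq_kummerCharacter_pow`), in additive form.
Ref: Serre, Invent. Math. 15 (1972), §1.3 and §1.7 Prop. 5; Serre, *Local Fields*, Ch. IV §2,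
Cor. 1 of Prop. 7. [cite: SerreInventiones1972, §1.3, §1.7 Prop. 5] -/
theorem tame_character_eq_zsmul_on_absInertia
    (lam psi : absoluteGaloisGroup F → AddCircle (1 : ℚ))
    (hlam_lc : IsLocallyConstant lam) (hlam : ∀ σ τ, lam (σ * τ) = lam σ + lam τ)
    (hpsi_lc : IsLocallyConstant psi) (hpsi : ∀ σ τ, psi (σ * τ) = psi σ + psi τ)
    {d : ℕ} (hd : 0 < d) (hpd : ¬ ringChar 𝓀[F] ∣ d)
    (hlamd : ∀ σ ∈ absInertia F, d • lam σ = 0) (hpsid : ∀ σ ∈ absInertia F, d • psi σ = 0)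
    (hfull : ∃ σ₀ ∈ absInertia F, psi σ₀ = (((1 : ℚ) / d : ℚ) : AddCircle (1 : ℚ))) :
    ∃ k : ℤ, ∀ σ ∈ absInertia F, lam σ = k • psi σ := by
  classical
  -- the common kernel `N ≤ I_F`
  let N : Subgroup (absInertia F) :=
    { carrier := {τ | lam τ = 0 ∧ psi τ = 0}
      mul_mem' := fun {a b} ha hb => by
        refine ⟨?_, ?_⟩
        · rw [Subgroup.coe_mul, hlam, ha.1, hb.1, add_zero]
        · rw [Subgroup.coe_mul, hpsi, ha.2, hb.2, add_zero]
      one_mem' := ⟨character_apply_one hlam, character_apply_one hpsi⟩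
      inv_mem' := fun {a} ha => by
        refine ⟨?_, ?_⟩
        · rw [Subgroup.coe_inv, character_apply_inv hlam, ha.1, neg_zero]
        · rw [Subgroup.coe_inv, character_apply_inv hpsi, ha.2, neg_zero] }
  have hN : ∀ τ : absInertia F, τ ∈ N ↔ lam τ = 0 ∧ psi τ = 0 := fun τ => Iff.rfl
  have hNd : ∀ τ : absInertia F, τ ^ d ∈ N := fun τ => by
    rw [hN, Subgroup.coe_pow, character_apply_pow hlam, character_apply_pow hpsi]
    exact ⟨hlamd τ τ.2, hpsid τ τ.2⟩
  -- a finite Galois level through which both characters factor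
  have hU : IsOpen ((lam ⁻¹' {0}) ∩ (psi ⁻¹' {0})) :=
    (hlam_lc.isOpen_fiber 0).inter (hpsi_lc.isOpen_fiber 0)
  obtain ⟨E, hEfin, hEgal, hE⟩ := exists_isGalois_mem_of_restrict_eq_one F hU
    ⟨character_apply_one hlam, character_apply_one hpsi⟩
  haveI := hEfin
  haveI := hEgal
  obtain ⟨g, hg⟩ := absInertia_exists_eq_mul_zpow F hpd N hNd E (fun τ hτ => hE _ hτ)
  -- evaluation of the characters on `ν g^n`
  have eval : ∀ (σ : absInertia F) (n : ℤ) (ν : absInertia F), ν ∈ N → σ = ν * g ^ n →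
      lam σ = n • lam g ∧ psi σ = n • psi g := fun σ n ν hν h => by
    have h' : (σ : absoluteGaloisGroup F) = ν * (g : absoluteGaloisGroup F) ^ n := by
      rw [h, Subgroup.coe_mul, SubgroupClass.coe_zpow]
    rw [hN] at hν
    refine ⟨?_, ?_⟩
    · rw [h', hlam, character_apply_zpow hlam, hν.1, zero_add]
    · rw [h', hpsi, character_apply_zpow hpsi, hν.2, zero_add]
  -- `lam g` is `d`-torsion: `lam g = k₀ • (1/d)`
  haveI : NeZero d := ⟨hd.ne'⟩
  obtain ⟨e, -, he_apply, he_surj⟩ := zmod_exists_addMonoidHom_addCircle hd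
  obtain ⟨k₀, hk₀⟩ := he_surj (lam g) (hlamd g g.2)
  have hlamg : lam g = ((k₀.val : ℕ) : ℤ) • ((((1 : ℚ) / d : ℚ)) : AddCircle (1 : ℚ)) := by
    have h1 : lam g = e (((k₀.val : ℕ) : ℤ) : ZMod d) := by
      rw [Int.cast_natCast, ZMod.natCast_zmod_val, hk₀]
    rw [h1, he_apply, ← AddCircle.coe_zsmul, zsmul_eq_mul, mul_one_div]
  -- `1/d = psi σ₀ = n₀ • psi g`
  obtain ⟨σ₀, hσ₀, hpsi₀⟩ := hfull
  obtain ⟨n₀, ν₀, hν₀, h₀⟩ := hg ⟨σ₀, hσ₀⟩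
  have hone : (((1 : ℚ) / d : ℚ) : AddCircle (1 : ℚ)) = n₀ • psi g := by
    rw [← hpsi₀]
    exact (eval _ _ _ hν₀ h₀).2
  refine ⟨((k₀.val : ℕ) : ℤ) * n₀, fun σ hσ => ?_⟩
  obtain ⟨n, ν, hν, h⟩ := hg ⟨σ, hσ⟩
  obtain ⟨hl, hp⟩ := eval ⟨σ, hσ⟩ n ν hν h
  rw [show lam σ = lam ((⟨σ, hσ⟩ : absInertia F) : absoluteGaloisGroup F) from rfl, hl, hlamg, hone,
    show psi σ = psi ((⟨σ, hσ⟩ : absInertia F) : absoluteGaloisGroup F) from rfl, hp,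
    ← mul_zsmul, ← mul_zsmul, ← mul_zsmul]
  ring_nf

end Local

end Literature.NumberTheory.GaloisRepresentations

end
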